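import Summits.BirchSwinnertonDyer.Rank1Residual.X5.TwoAdicTargetsEnd
import Summits.BirchSwinnertonDyer.Rank1Residual.X5.TwoAdicTargetsMC
import Literature.NumberTheory.EllipticCurves.Wuthrich2014.ShaBoundProofs
import HarnessLib

/-!
# Class O1 (X5, `p = 2`, non-CM): G11a′ — the `2`-adic chain with a RATIONAL normaliser, PROVED,
# and what the typed item `MainConjectureLowerDivisibilityAtTwoOrd` actually delivers (the UPPER half)

HONEST FRAMING (cell `b2b-bsdres`, run/shared/lean/b2b/bsd-rank1-residual/, verbatim in every
file): the goal of the cell is to DELETE the COMBINATION-SHAPED residual classes of the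
Birch–Swinnerton-Dyer formula for ALL analytic-rank `≤ 1` elliptic curves over `ℚ` — "full BSD
formula for every rank `≤ 1` curve in class `C`" assembled STRICTLY from published theorems — so
that the rank-`≤ 1` remainder becomes exactly the CONSTRUCTION-SHAPED classes, which are TYPED
(missing-input `Prop`s), NOT attempted. This is not "finishing BSD". Research routes; no claim
beyond stated classes; census output = EVIDENCE, never a Literature fact; nothing here is booked;
no mark of RESIDUAL-MAP §I moves.

Unit `b2b-bsdres-cc-typer-4` (lane CLASS-CLOSURE, class O1), gen 3: the o1 class lead's
successor-typer queue item (1), second half (`HOME/cells/o1/PLAN.md` v2.4 §12.6 C37, §11.7 C31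
"G11a′: the rational-normaliser form, sharp at `ϖ′ = ϖ_{E*}`; needed because A-PER2 is unavailable
on reducible `E[2]`"). THEOREMS ONLY (no definition, no named fact).

* **G11a′ `chainUpperAtTwo_of_divisibilityRat` (PROVED)** — the chain G11a
  (`X5/TwoAdicTargetsEnd.lean`) with the datum `ι g = 2ⁿ · L₂(f, α)` replaced by `ι g = ϖ′ · L₂(f, α)`
  for any non-zero RATIONAL `ϖ′` (`g ∈ char_Λ X`, `X` torsion): good ordinary `2`, `L(E,1) ≠ 0`, `Ш`
  finite, Greenberg Thm. 4.1 AT `2` as the hypothesis `hEC : TwoAdicEulerCharRankZero W 0` (in print)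
  ⇒ `t = L(E,1)/Ω_E ∈ ℚ` with (a) `ord₂ #Ш + ord₂ ∏c_ℓ − 2 ord₂ #E(ℚ)_tors + ord₂ ϖ ≤ ord₂ t + ord₂ ϖ′`
  (`ϖ · Ω_E = Ω⁺_f`) and (b) the reverse inequality forces `char_Λ X = (g)`. The refuter's `μ = 0`
  upgrade (`X5/TwoAdicMuZeroUpgrade.lean`, `charIdeal_dvd_of_kato_allPrimes_of_mu_eq_zero`) produces
  exactly such a datum for any rational `ϖ′` making `ϖ′ · L₂(f, α)` integral; at `ϖ′ = ϖ` clause (a)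
  is the SHARP upper bound `ord₂ #Ш ≤ ord₂ #Ш_an`. Packaged: `mainConjectureAtTwo_of_divisibilityRat_of_le`
  ((b)) and `upperBound_two_of_divisibilityRat` ((a) in Miller's currency, slack `ord₂ ϖ′ − ord₂ ϖ ≤ k`).
* **ORIENTATION of the typed E2 residue (kernel fact, for the o1 lead / refuter):
  `missingUpperBoundAt_two_of_mainConjectureLowerDivisibilityAtTwoOrd` (PROVED).** The item
  `O1.MainConjectureLowerDivisibilityAtTwoOrd W` (`X5/TwoAdicTargetsMC.lean`; body: for the Néron
  `ϖ`, `∃ g ∈ char_Λ X, ι g = ϖ · L₂(f, α)`, i.e. `char_Λ X ∣ 𝓛₂^{MSD}(E)` integrally) is, by G11a′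
  at `ϖ′ = ϖ`, the Néron-normalised INTEGRAL KATO divisibility at `2`: on a rank-`0` good-ordinary-`2`
  curve it delivers — granted Greenberg 4.1 at `2`, modularity, GZK and `X` torsion (Kato 17.4 (1) at
  `2`, in print) — the SHARP UPPER half `MissingUpperBoundAt W 2`, with NO image hypothesis, NO
  period-unit input, NO slack. Its docstrings (p249352 / p251644) name it "the Eisenstein
  (Skinner–Urban) half" and the PLAN files it as the class-level source F4 of the LOWER half; the
  kernel theorem shows the direction is Kato's (`char X ∣ L`, upper bound on `Ш`). The Eisenstein
  direction (`L ∣ char X` ⇒ `MissingLowerBoundAt W 2`) is typed in `X5/TwoAdicTargetsEisenstein.lean`.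
  (Statement-level finding, gen 3; no def edited — append-only; nothing false was proved from the
  item, whose only consumers are the refuter's junk/guard lemmas.)

Nothing is booked; `BSD(E,2)` on any residue cell still needs a LOWER-half input (per pair: a
certificate; per class: the Eisenstein half at `2`, NOT in print) and, off the `μ = 0` locus, the E2
target at `k ≤ 1`. References: [GreenbergLNM1716] Thm. 4.1 (p. 102), §5; [Kato2004Asterisque] Thm. 17.4 (p. 273);
[MazurTateTeitelbaum1986Invent] §I.14 (14.3); [GreenbergVatsal2000] p. 4; [Miller2011LMS] Def. 1.1.
-/

set_option autoImplicit false

noncomputable section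

open scoped Classical MatrixGroups ModularForm

open CongruenceSubgroup WeierstrassCurve Literature.NumberTheory.EllipticCurves
  Literature.NumberTheory.EllipticCurves.ModularForms
  Literature.NumberTheory.EllipticCurves.Wuthrich2014
  Literature.NumberTheory.EllipticCurves.Rank1Residual
  Literature.NumberTheory.EllipticCurves.Rank1Residual.Typed

namespace Summit.BirchSwinnertonDyer.Rank1Residual.X5.O1

variable (W : WeierstrassCurve ℚ) [W.IsElliptic] [W.IsGloballyMinimal]

/-! ## G11a′ — the `2`-adic chain from ONE divisibility datum with a rational normaliser `ϖ′` -/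

/-- **G11a′ — the chain at `2` from ONE divisibility datum `ι g = ϖ′ · L₂(f, α)`, `ϖ′ ∈ ℚ^×` (any
image).** Let `W` be a globally minimal model of `E/ℚ`, good ordinary at `2` (`hord`), `L(E,1) ≠ 0`
(`hL`), `Ш(E/ℚ)` finite (`hfin`); Greenberg's Theorem 4.1 AT `2` as the hypothesis `hEC`
(`TwoAdicEulerCharRankZero W 0`, in print). For a cyclotomic datum, a newform `f` of `E`, a dual
datum `D`, the period ratio `ϖ` (`ϖ · Ω_E = Ω⁺_f`), a non-zero rational `ϖ′` and the datum (`hdiv`)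
"`X` torsion and `ϖ′ · L₂(f, α) = ι g` for some `g ∈ char_Λ X`": `L(E,1)/Ω_E` is a rational `t` with
(a) `ord₂ #Ш + ord₂ ∏ c_ℓ - 2 ord₂ #E(ℚ)_tors + ord₂ ϖ ≤ ord₂ t + ord₂ ϖ′`, and (b) the reverse
inequality forces `char_Λ X = (g)`. Proof = G11a verbatim with `2ⁿ ↦ ϖ′` (`g = h · f_E`,
`g(0) = ϖ′ (1 - α⁻¹)² [0]⁺_f`, `[0]⁺_f = t/ϖ`, Thm. 4.1 at `2`, the anomalous factor cancels,
`ord₂ h(0) ≥ 0`; under (b) `h ∈ Λ^×`). [cite: GreenbergLNM1716, Thm. 4.1 (p. 102) and §5 (closing examples)]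
[cite: MazurTateTeitelbaum1986Invent, §I.14 (14.3)] [cite: GreenbergVatsal2000, p. 4 (after Thm. (1.2))] -/
theorem chainUpperAtTwo_of_divisibilityRat (hEC : TwoAdicEulerCharRankZero W 0)
    (hord : IsOrdinaryAt W 2) (hL : W.entireLFunction 1 ≠ 0) (hfin : Finite W.sha)
    {κ : ZpExtension ℚ 2} {γ : Field.absoluteGaloisGroup ℚ} {N : ℕ} [NeZero N]
    {f : CuspForm (Gamma0 N) 2} (hκ : κ.IsCyclotomic) (hγ : κ.IsTopGenerator γ)
    (hγ' : IsCyclotomicVariable 2 γ) (hf : IsNewformOf W f) (D : W.SelmerDualData κ γ) (ϖ : ℚ)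
    (hϖ : (ϖ : ℝ) * W.realPeriodRat = plusPeriod f) {ϖ' : ℚ} (hϖ'0 : ϖ' ≠ 0)
    (hdiv : D.IsTorsion ∧ ∃ g ∈ D.charIdeal, iwasawaToPowerSeries 2 g =
        PowerSeries.C (ϖ' : ℚ_[2]) * padicLFunction f (unitRoot W 2 : ℚ_[2])) :
    ∃ t : ℚ, W.entireLFunction 1 / (W.realPeriodRat : ℂ) = (t : ℂ) ∧
      (padicValNat 2 W.shaOrder : ℤ) + padicValNat 2 W.tamagawaProduct -
          2 * padicValNat 2 W.torsionOrder + padicValRat 2 ϖ ≤ padicValRat 2 t + padicValRat 2 ϖ' ∧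
      (padicValRat 2 t + padicValRat 2 ϖ' ≤ (padicValNat 2 W.shaOrder : ℤ) +
          padicValNat 2 W.tamagawaProduct - 2 * padicValNat 2 W.torsionOrder + padicValRat 2 ϖ →
        D.IsTorsion ∧ ∃ g : IwasawaAlgebra 2, D.charIdeal = Ideal.span {g} ∧
          iwasawaToPowerSeries 2 g =
            PowerSeries.C (ϖ' : ℚ_[2]) * padicLFunction f (unitRoot W 2 : ℚ_[2])) := by
  -- Step 0: the rational number `t = ϖ · [0]⁺_f = L(E,1)/Ω_E`, non-zero; `s = [0]⁺_f`
  have hΩpos : 0 < W.realPeriodRat := W.realPeriodRat_pos_holds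
  have hϖ0 : ϖ ≠ 0 := by
    rintro rfl
    have hper : 0 < plusPeriod f := IsNewform0.plusPeriod_pos_holds hf.1 hf.coeffField_eq_bot
    rw [← hϖ, Rat.cast_zero, zero_mul] at hper
    exact lt_irrefl _ hper
  set s : ℚ := ratPlusSymbol f 0 with hs_def
  set t : ℚ := ϖ * s with ht_def
  have hLval : W.entireLFunction 1 = (((s : ℝ) * plusPeriod f : ℝ) : ℂ) := hf.entireLFunction_one_eq
  have hq : W.entireLFunction 1 / (W.realPeriodRat : ℂ) = ((t : ℚ) : ℂ) := by
    rw [hLval, ← hϖ, div_eq_iff (Complex.ofReal_ne_zero.mpr hΩpos.ne'), ht_def]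
    push_cast
    ring
  have hs0 : s ≠ 0 := by
    intro h0
    apply hL
    rw [hLval, h0]
    simp
  have hvt : padicValRat 2 t = padicValRat 2 ϖ + padicValRat 2 s := by
    rw [ht_def, padicValRat.mul hϖ0 hs0]
  -- Step 1 (the Iwasawa module)
  haveI : Module.Finite (IwasawaAlgebra 2) D.X := D.module_finite_holds hγ
  -- Step 2 (the divisibility datum): `X` torsion and `ι g = ϖ′ · L₂(f, α)` for some `g ∈ char_Λ X`;
  -- a generator `fE` of the (principal) characteristic ideal, and the cofactor `h`: `g = h · fE`
  obtain ⟨hX, g, hgmem, hιg⟩ := hdiv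
  haveI : (Module.charIdeal (IwasawaAlgebra 2) D.X).IsPrincipal := charIdeal_isPrincipal_holds 2 D.X
  obtain ⟨fE, hchar⟩ := Submodule.IsPrincipal.principal (Module.charIdeal (IwasawaAlgebra 2) D.X)
  have hchar' : D.charIdeal = Ideal.span {fE} := hchar
  have hgmem' : g ∈ Ideal.span {fE} := by rw [← hchar']; exact hgmem
  obtain ⟨h, hgh⟩ := Ideal.mem_span_singleton'.mp hgmem'
  -- Step 3 (interpolation): `g(0) = ϖ′ · (1 - α⁻¹)² [0]⁺_f`
  set a : ℚ_[2] := ((unitRoot W 2 : ℤ_[2]) : ℚ_[2]) with ha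
  have hg0 : ((PowerSeries.constantCoeff g : ℤ_[2]) : ℚ_[2]) =
      (ϖ' : ℚ_[2]) * (1 - a⁻¹) ^ 2 * (s : ℚ_[2]) := by
    rw [← constantCoeff_iwasawaToPowerSeries 2 g, hιg, map_mul, PowerSeries.constantCoeff_C,
      constantCoeff_padicLFunction_unitRoot hord hf]
    ring
  -- `g(0) = h(0) · fE(0)`
  have hg0' : (PowerSeries.constantCoeff g : ℤ_[2]) =
      PowerSeries.constantCoeff h * PowerSeries.constantCoeff fE := by
    rw [← hgh, map_mul]
  -- the bridges `1 - α⁻¹ = u₂ · #Ẽ(𝔽₂)` and `#Ẽ(𝔽₂) = u₃ · #Ẽ(𝔽₂)(2)`; in particular `1 - α⁻¹ ≠ 0`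
  obtain ⟨u₂, hu₂⟩ := exists_unit_one_sub_unitRoot_inv 2 W hord
  haveI : NeZero (2 : ℕ) := ⟨two_ne_zero⟩
  obtain ⟨u₃, hu₃⟩ := exists_unit_natCard_eq_mul_card_primaryComponent
    ((integralModelInt W).map (Int.castRingHom (ZMod 2))).toAffine.Point 2
  set Np : ℚ_[2] := (Nat.card (AddCommGroup.primaryComponent
    ((integralModelInt W).map (Int.castRingHom (ZMod 2))).toAffine.Point 2) : ℚ_[2]) with hNp
  have hNcount : (W.reductionPointCount 2 : ℚ_[2]) = ((u₃ : ℤ_[2]) : ℚ_[2]) * Np := by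
    rw [WeierstrassCurve.reductionPointCount, hNp]
    exact hu₃
  have hNp0 : Np ≠ 0 := by
    rw [hNp]
    exact_mod_cast Nat.card_pos.ne'
  have h1 : (1 - a⁻¹) = ((u₂ : ℤ_[2]) : ℚ_[2]) * ((u₃ : ℤ_[2]) : ℚ_[2]) * Np := by
    rw [hu₂, hNcount, mul_assoc]
  have hsQ0 : (s : ℚ_[2]) ≠ 0 := by exact_mod_cast hs0
  have hϖ'Q0 : (ϖ' : ℚ_[2]) ≠ 0 := by exact_mod_cast hϖ'0
  have hU0 : ((u₂ : ℤ_[2]) : ℚ_[2]) * ((u₃ : ℤ_[2]) : ℚ_[2]) ≠ 0 :=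
    mul_ne_zero (coe_units_ne_zero 2 u₂) (coe_units_ne_zero 2 u₃)
  have h20 : (2 : ℚ_[2]) ≠ 0 := two_ne_zero
  -- Step 4 (finiteness): `g(0) ≠ 0`, hence `fE(0) ≠ 0`, `h(0) ≠ 0`, `Sel_{2^∞}(E/ℚ)` finite
  have hg00 : PowerSeries.constantCoeff g ≠ 0 := by
    intro h0
    rw [h0, PadicInt.coe_zero, h1] at hg0
    exact (mul_ne_zero (mul_ne_zero hϖ'Q0
      (pow_ne_zero 2 (mul_ne_zero hU0 hNp0))) hsQ0) hg0.symm
  have hfE00 : PowerSeries.constantCoeff fE ≠ 0 := by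
    intro h0
    apply hg00
    rw [hg0', h0, mul_zero]
  have hh00 : PowerSeries.constantCoeff h ≠ 0 := by
    intro h0
    apply hg00
    rw [hg0', h0, zero_mul]
  have hSelfin : Finite (W.selmerGroupPInfty 2) :=
    D.finite_selmerGroupPInfty_of_constantCoeff_ne_zero W hγ hX fE hchar' hfE00
  obtain ⟨hEfin, hShapfin⟩ := (W.finite_selmerGroupPInfty_iff 2).mp hSelfin
  haveI := hEfin
  haveI := hShapfin
  haveI := hSelfin
  haveI : Finite W.sha := hfin
  -- Step 5 (Greenberg's Thm. 4.1 AT 2 — the hypothesis `hEC`, slot `δ = 0` — for the generator `fE`)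
  obtain ⟨u₁, hu₁⟩ := hEC hord κ γ hκ hγ hγ' D hX fE hchar' hSelfin
  rw [add_zero, zpow_natCast] at hu₁
  -- Step 6 (the remaining bridges)
  obtain ⟨u₄, hu₄⟩ := exists_unit_torsionOrder_eq W 2
  obtain ⟨u₅, hu₅⟩ := exists_unit_natCard_eq_mul_card_primaryComponent W.sha 2
  have hSel : Nat.card (W.selmerGroupPInfty 2) = Nat.card (AddCommGroup.primaryComponent W.sha 2) :=
    W.natCard_selmerGroupPInfty_eq_natCard_primaryComponent_sha 2
  -- abbreviations
  set v := padicValNat 2 W.tamagawaProduct with hv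
  set Tp : ℚ_[2] := (Nat.card (AddCommGroup.primaryComponent W.toAffine.Point 2) : ℚ_[2]) with hTp
  set Shp : ℚ_[2] := (Nat.card (AddCommGroup.primaryComponent W.sha 2) : ℚ_[2]) with hShp
  set h0 : ℚ_[2] := ((PowerSeries.constantCoeff h : ℤ_[2]) : ℚ_[2]) with hh0
  have hh0ne : h0 ≠ 0 := by
    rw [hh0]
    intro h0'
    exact hh00 (by exact_mod_cast (PadicInt.coe_eq_zero.mp h0'))
  have hh0val : 0 ≤ h0.valuation := by
    rw [hh0]
    exact PadicInt.valuation_coe_nonneg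
  -- `#E(ℚ)_tors = u₄ · Tp` (up to the `DecidableEq ℚ` instance inside the group law)
  have hu₄' : (W.torsionOrder : ℚ_[2]) = ((u₄ : ℤ_[2]) : ℚ_[2]) * Tp := by
    rw [hu₄, hTp]
    congr 1
    exact_mod_cast natCard_primaryComponent_point_congr W 2 _ _
  -- `#Ш = u₅ · Shp`, `#Sel = Shp`
  have hSha : (W.shaOrder : ℚ_[2]) = ((u₅ : ℤ_[2]) : ℚ_[2]) * Shp := by
    rw [WeierstrassCurve.shaOrder, hShp]
    exact hu₅
  have hSel' : (Nat.card (W.selmerGroupPInfty 2) : ℚ_[2]) = Shp := by rw [hShp, hSel]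
  -- `g(0) = h0 · fE(0)` in `ℚ_2`
  have hg0Q : ((PowerSeries.constantCoeff g : ℤ_[2]) : ℚ_[2]) =
      h0 * ((PowerSeries.constantCoeff fE : ℤ_[2]) : ℚ_[2]) := by
    rw [hg0', hh0]; push_cast; ring
  -- Step 7: the identity `ϖ′ · s · Tp² · (u₂ u₃)² = h0 · u₁ · 2^v · Shp` in `ℚ_2`
  have key : (ϖ' : ℚ_[2]) * (s : ℚ_[2]) * Tp ^ 2 *
      (((u₂ : ℤ_[2]) : ℚ_[2]) * ((u₃ : ℤ_[2]) : ℚ_[2])) ^ 2 =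
      h0 * (((u₁ : ℤ_[2]) : ℚ_[2]) * (2 : ℚ_[2]) ^ v * Shp) := by
    apply mul_right_cancel₀ (pow_ne_zero 2 hNp0)
    calc (ϖ' : ℚ_[2]) * (s : ℚ_[2]) * Tp ^ 2 *
          (((u₂ : ℤ_[2]) : ℚ_[2]) * ((u₃ : ℤ_[2]) : ℚ_[2])) ^ 2 * Np ^ 2
        = ((ϖ' : ℚ_[2]) * (1 - a⁻¹) ^ 2 * (s : ℚ_[2])) * Tp ^ 2 := by rw [h1]; ring
      _ = h0 * (((PowerSeries.constantCoeff fE : ℤ_[2]) : ℚ_[2]) * Tp ^ 2) := by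
          rw [← hg0, hg0Q]; ring
      _ = h0 * (((u₁ : ℤ_[2]) : ℚ_[2]) * (2 : ℚ_[2]) ^ v * Np ^ 2 *
            (Nat.card (W.selmerGroupPInfty 2) : ℚ_[2])) := by rw [hu₁]
      _ = h0 * (((u₁ : ℤ_[2]) : ℚ_[2]) * (2 : ℚ_[2]) ^ v * Shp) * Np ^ 2 := by rw [hSel']; ring
  -- Step 8: valuations
  have hTp0 : Tp ≠ 0 := by rw [hTp]; exact_mod_cast Nat.card_pos.ne'
  have hShp0 : Shp ≠ 0 := by rw [hShp]; exact_mod_cast Nat.card_pos.ne'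
  have hv2 : (2 : ℚ_[2]).valuation = 1 := by
    have h2 : ((2 : ℕ) : ℚ_[2]).valuation = 1 := Padic.valuation_p
    rwa [Nat.cast_ofNat] at h2
  have hvalL : ((ϖ' : ℚ_[2]) * (s : ℚ_[2]) * Tp ^ 2 *
      (((u₂ : ℤ_[2]) : ℚ_[2]) * ((u₃ : ℤ_[2]) : ℚ_[2])) ^ 2).valuation =
      padicValRat 2 ϖ' + padicValRat 2 s + 2 * Tp.valuation := by
    rw [Padic.valuation_mul (mul_ne_zero (mul_ne_zero hϖ'Q0 hsQ0) (pow_ne_zero 2 hTp0))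
        (pow_ne_zero 2 hU0),
      Padic.valuation_mul (mul_ne_zero hϖ'Q0 hsQ0) (pow_ne_zero 2 hTp0),
      Padic.valuation_mul hϖ'Q0 hsQ0, Padic.valuation_pow Tp, Padic.valuation_pow,
      Padic.valuation_mul (coe_units_ne_zero 2 u₂) (coe_units_ne_zero 2 u₃),
      valuation_coe_units_eq_zero, valuation_coe_units_eq_zero, Padic.valuation_ratCast,
      Padic.valuation_ratCast]
    push_cast
    ring
  have hvalR : (h0 * (((u₁ : ℤ_[2]) : ℚ_[2]) * (2 : ℚ_[2]) ^ v * Shp)).valuation =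
      h0.valuation + (v + Shp.valuation) := by
    rw [Padic.valuation_mul hh0ne
        (mul_ne_zero (mul_ne_zero (coe_units_ne_zero 2 u₁) (pow_ne_zero v h20)) hShp0),
      Padic.valuation_mul (mul_ne_zero (coe_units_ne_zero 2 u₁) (pow_ne_zero v h20)) hShp0,
      Padic.valuation_mul (coe_units_ne_zero 2 u₁) (pow_ne_zero v h20), valuation_coe_units_eq_zero,
      Padic.valuation_pow, hv2]
    ring
  have hval := congrArg Padic.valuation key
  rw [hvalL, hvalR] at hval
  -- `v(Tp) = v(#E(ℚ)_tors)`, `v(Shp) = v(#Ш)`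
  have hvT : Tp.valuation = (padicValNat 2 W.torsionOrder : ℤ) := by
    have h := congrArg Padic.valuation hu₄'
    rw [Padic.valuation_natCast, Padic.valuation_mul (coe_units_ne_zero 2 u₄) hTp0,
      valuation_coe_units_eq_zero, zero_add] at h
    exact h.symm
  have hvS : Shp.valuation = (padicValNat 2 W.shaOrder : ℤ) := by
    have h := congrArg Padic.valuation hSha
    rw [Padic.valuation_natCast, Padic.valuation_mul (coe_units_ne_zero 2 u₅) hShp0,
      valuation_coe_units_eq_zero, zero_add] at h
    exact h.symm
  rw [hvT, hvS] at hval
  refine ⟨t, hq, by linarith, fun hle => ?_⟩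
  -- Step 9: the reverse inequality forces `ord₂ h(0) = 0`, so `h(0) ∈ ℤ_2^×` and `h ∈ Λ^×`
  have hh0zero : h0.valuation = 0 := by linarith
  have hvalh : (PowerSeries.constantCoeff h : ℤ_[2]).valuation = 0 := by
    have h' : (((PowerSeries.constantCoeff h : ℤ_[2]) : ℚ_[2])).valuation = 0 := by
      rw [← hh0]; exact hh0zero
    rw [PadicInt.valuation_coe] at h'
    exact_mod_cast h'
  have hunit0 : IsUnit (PowerSeries.constantCoeff h : ℤ_[2]) := by
    rw [PadicInt.isUnit_iff, PadicInt.norm_eq_zpow_neg_valuation hh00, hvalh]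
    simp
  have hunit : IsUnit h := PowerSeries.isUnit_iff_constantCoeff.mpr hunit0
  -- Step 10: `char_Λ X = (fE) = (h · fE) = (g)`
  refine ⟨hX, g, ?_, hιg⟩
  rw [hchar', ← hgh, Ideal.span_singleton_mul_left_unit hunit]

/-- **G11a′ (b), packaged — Mazur's main conjecture at a `2`-adic datum from the rational-normaliser
divisibility and the REVERSE inequality** (`ord₂ (L(E,1)/Ω_E) + ord₂ ϖ′ ≤ ord₂ #Ш + ord₂ ∏c_ℓ −
2 ord₂ #E(ℚ)_tors + ord₂ ϖ` ⇒ `char_Λ X = (g)`; at `ϖ′ = ϖ` this is the datum of the cell's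
`MazurMainConjecture W 2`). [cite: GreenbergLNM1716, §5 (closing examples; shape)] -/
theorem mainConjectureAtTwo_of_divisibilityRat_of_le (hEC : TwoAdicEulerCharRankZero W 0)
    (hord : IsOrdinaryAt W 2) (hL : W.entireLFunction 1 ≠ 0) (hfin : Finite W.sha)
    {κ : ZpExtension ℚ 2} {γ : Field.absoluteGaloisGroup ℚ} {N : ℕ} [NeZero N]
    {f : CuspForm (Gamma0 N) 2} (hκ : κ.IsCyclotomic) (hγ : κ.IsTopGenerator γ)
    (hγ' : IsCyclotomicVariable 2 γ) (hf : IsNewformOf W f) (D : W.SelmerDualData κ γ) (ϖ : ℚ)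
    (hϖ : (ϖ : ℝ) * W.realPeriodRat = plusPeriod f) {ϖ' : ℚ} (hϖ'0 : ϖ' ≠ 0)
    (hdiv : D.IsTorsion ∧ ∃ g ∈ D.charIdeal, iwasawaToPowerSeries 2 g =
        PowerSeries.C (ϖ' : ℚ_[2]) * padicLFunction f (unitRoot W 2 : ℚ_[2]))
    (hrev : ∀ t : ℚ, W.entireLFunction 1 / (W.realPeriodRat : ℂ) = (t : ℂ) →
      padicValRat 2 t + padicValRat 2 ϖ' ≤ (padicValNat 2 W.shaOrder : ℤ) +
          padicValNat 2 W.tamagawaProduct - 2 * padicValNat 2 W.torsionOrder + padicValRat 2 ϖ) :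
    D.IsTorsion ∧ ∃ g : IwasawaAlgebra 2, D.charIdeal = Ideal.span {g} ∧
      iwasawaToPowerSeries 2 g =
        PowerSeries.C (ϖ' : ℚ_[2]) * padicLFunction f (unitRoot W 2 : ℚ_[2]) := by
  obtain ⟨t, ht, -, hb⟩ :=
    chainUpperAtTwo_of_divisibilityRat W hEC hord hL hfin hκ hγ hγ' hf D ϖ hϖ hϖ'0 hdiv
  exact hb (hrev t ht)

/-- **G11a′ (a) in Miller's currency — the upper half with slack `k` from a rational-normaliser
datum** (`ι g = ϖ′ · L₂(f, α)`, `g ∈ char_Λ X`, `X` torsion, `ord₂ ϖ′ ≤ ord₂ ϖ + k`): good ordinary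
`2`, `L(E,1) ≠ 0`, GZK (`#Ш_an = t · #E(ℚ)² / ∏c_ℓ`, `shaAn_eq_of_L_one_div_eq`), Greenberg@2 ⇒
`∃ q, #Ш_an = q ∧ ord₂ #Ш ≤ ord₂ q + k`; at `k = 0` (e.g. `ϖ′ = ϖ`) this is `MissingUpperBoundAt W 2`.
[cite: Miller2011LMS, Def. 1.1 and §1] [cite: GreenbergLNM1716, Thm. 4.1 (p. 102)] -/
theorem upperBound_two_of_divisibilityRat (hEC : TwoAdicEulerCharRankZero W 0)
    (hGZK : rank_eq_analyticRank_of_analyticRank_le_one)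
    (hord : IsOrdinaryAt W 2) (hL : W.entireLFunction 1 ≠ 0)
    {κ : ZpExtension ℚ 2} {γ : Field.absoluteGaloisGroup ℚ} {N : ℕ} [NeZero N]
    {f : CuspForm (Gamma0 N) 2} (hκ : κ.IsCyclotomic) (hγ : κ.IsTopGenerator γ)
    (hγ' : IsCyclotomicVariable 2 γ) (hf : IsNewformOf W f) (D : W.SelmerDualData κ γ) (ϖ : ℚ)
    (hϖ : (ϖ : ℝ) * W.realPeriodRat = plusPeriod f) {ϖ' : ℚ} (hϖ'0 : ϖ' ≠ 0) (k : ℕ)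
    (hk : padicValRat 2 ϖ' ≤ padicValRat 2 ϖ + k)
    (hdiv : D.IsTorsion ∧ ∃ g ∈ D.charIdeal, iwasawaToPowerSeries 2 g =
        PowerSeries.C (ϖ' : ℚ_[2]) * padicLFunction f (unitRoot W 2 : ℚ_[2])) :
    ∃ q : ℚ, shaAn W = (q : ℂ) ∧ (padicValNat 2 W.shaOrder : ℤ) ≤ padicValRat 2 q + k := by
  have hr : W.analyticRank = 0 := analyticRank_eq_zero_of_entireLFunction_one_ne_zero W hL
  obtain ⟨-, hfin⟩ := hGZK W (by rw [hr]; exact zero_le_one)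
  obtain ⟨t, ht, hle, -⟩ :=
    chainUpperAtTwo_of_divisibilityRat W hEC hord hL hfin hκ hγ hγ' hf D ϖ hϖ hϖ'0 hdiv
  -- Miller's currency: `#Ш_an = t · #E(ℚ)² / ∏ c_ℓ`
  obtain ⟨-, hE, -, hshaAn⟩ := shaAn_eq_of_L_one_div_eq hGZK W hL ht
  haveI := hE
  have hΩ : (W.realPeriodRat : ℂ) ≠ 0 := by exact_mod_cast W.realPeriodRat_pos_holds.ne'
  have ht0 : t ≠ 0 := by
    rintro rfl
    apply hL
    rw [Rat.cast_zero, div_eq_zero_iff] at ht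
    exact ht.resolve_right hΩ
  have hcard : (Nat.card W.toAffine.Point : ℚ) ≠ 0 := by
    exact_mod_cast (Nat.card_pos (α := W.toAffine.Point)).ne'
  have htam : (W.tamagawaProduct : ℚ) ≠ 0 := by
    exact_mod_cast (W.tamagawaProduct_pos_holds : 0 < W.tamagawaProduct).ne'
  have hcardT : (Nat.card W.toAffine.Point : ℚ) = (W.torsionOrder : ℚ) := by
    exact_mod_cast (W.torsionOrder_eq_natCard_of_finite).symm
  refine ⟨t * (Nat.card W.toAffine.Point : ℚ) ^ 2 / (W.tamagawaProduct : ℚ), hshaAn, ?_⟩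
  rw [padicValRat.div (mul_ne_zero ht0 (pow_ne_zero 2 hcard)) htam,
    padicValRat.mul ht0 (pow_ne_zero 2 hcard), padicValRat.pow, hcardT]
  simp only [padicValRat.of_nat, Nat.cast_ofNat]
  linarith

/-! ## ORIENTATION — the typed item `MainConjectureLowerDivisibilityAtTwoOrd` delivers the UPPER half -/

/-- **ORIENTATION (kernel fact): `O1.MainConjectureLowerDivisibilityAtTwoOrd W` ⇒ the SHARP UPPER
half `MissingUpperBoundAt W 2` on a rank-`0` good-ordinary-`2` curve** — granted Greenberg 4.1 at `2`
(`hEC`, in print), modularity, GZK and `X(E/ℚ_∞)` torsion for the cyclotomic data (`hX`; Kato 17.4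
(1) at `2`, in print — see `…_of_kato`). By G11a′ at `ϖ′ = ϖ`: the item's body
"`∃ g ∈ char_Λ X, ι g = ϖ · L₂(f, α)`" is `char_Λ X ∣ 𝓛₂^{MSD}(E)` in `Λ` — the KATO direction at `2`
in Néron normalisation, integral, no image hypothesis — so on O1-go ∧ r0 it buys
`ord₂ #Ш ≤ ord₂ #Ш_an` (upper), NOT the lower half its docstrings name ("Eisenstein (Skinner–Urban)
half", p249352/p251644; PLAN F4). The Eisenstein direction is typed in `X5/TwoAdicTargetsEisenstein.lean`.
[cite: Miller2011LMS, Def. 1.1] [cite: GreenbergLNM1716, Thm. 4.1 (p. 102)]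
[cite: Kato2004Asterisque, Thm. 17.4 (1) (p. 273)] -/
theorem missingUpperBoundAt_two_of_mainConjectureLowerDivisibilityAtTwoOrd
    (hEC : TwoAdicEulerCharRankZero W 0) (hmod : nonempty_modularParametrizationData)
    (hGZK : rank_eq_analyticRank_of_analyticRank_le_one)
    (hX : ∀ (κ : ZpExtension ℚ 2) (γ : Field.absoluteGaloisGroup ℚ), κ.IsCyclotomic →
      κ.IsTopGenerator γ → IsCyclotomicVariable 2 γ → ∀ D : W.SelmerDualData κ γ, D.IsTorsion)
    (hr : W.analyticRank = 0) (hgo : GoodOrd W 2) (h : MainConjectureLowerDivisibilityAtTwoOrd W) :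
    MissingUpperBoundAt W 2 := by
  have hord : IsOrdinaryAt W 2 := hgo
  haveI : NeZero (W.conductorNorm ℤ) := ⟨(W.conductorNorm_pos_holds).ne'⟩
  obtain ⟨Dm⟩ := hmod W
  have hf : IsNewformOf W Dm.f := Dm.isNewformOf
  have hL : W.entireLFunction 1 ≠ 0 :=
    (W.analyticRank_eq_zero_iff_holds hf.hasEntireLFunction).mp hr
  obtain ⟨ϖ, hϖpos, hϖeq, -⟩ := Dm.exists_rat_mul_realPeriodRat_eq_plusPeriod
  obtain ⟨κ, hκ, γ, hγ, hγ'⟩ := exists_isCyclotomic_isTopGenerator_isCyclotomicVariable_holds 2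
  obtain ⟨D⟩ := W.nonempty_selmerDualData_holds κ γ hγ
  obtain ⟨g, hg, hι⟩ := h κ γ hκ hγ hγ' hord Dm.f hf ϖ hϖeq D
  obtain ⟨q, hq, hle⟩ := upperBound_two_of_divisibilityRat W hEC hGZK hord hL hκ hγ hγ' hf D ϖ hϖeq
    hϖpos.ne' 0 (by simp) ⟨hX κ γ hκ hγ hγ' D, g, hg, hι⟩
  exact ⟨q, hq, by simpa using hle⟩

/-- The same with `X` torsion supplied by Kato 17.4 (1) AT `2` (in print, parity-free, any image:
`kato_divisibility_allPrimes W 2`, clause (1)). [cite: Kato2004Asterisque, Thm. 17.4 (1) (p. 273)] -/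
theorem missingUpperBoundAt_two_of_mainConjectureLowerDivisibilityAtTwoOrd_of_kato
    (hEC : TwoAdicEulerCharRankZero W 0) (hmod : nonempty_modularParametrizationData)
    (hGZK : rank_eq_analyticRank_of_analyticRank_le_one)
    (h17 : ∀ [NeZero (W.conductorNorm ℤ)] (f : CuspForm (Gamma0 (W.conductorNorm ℤ)) 2),
      kato_divisibility_allPrimes W 2 (f := f))
    (hr : W.analyticRank = 0) (hgo : GoodOrd W 2) (h : MainConjectureLowerDivisibilityAtTwoOrd W) :
    MissingUpperBoundAt W 2 := by
  have hord : IsOrdinaryAt W 2 := hgo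
  haveI : NeZero (W.conductorNorm ℤ) := ⟨(W.conductorNorm_pos_holds).ne'⟩
  obtain ⟨Dm⟩ := hmod W
  exact missingUpperBoundAt_two_of_mainConjectureLowerDivisibilityAtTwoOrd W hEC hmod hGZK
    (fun κ γ hκ hγ hγ' D => (h17 Dm.f κ γ hκ hγ hγ' hord Dm.isNewformOf D).1) hr hgo h

end Summit.BirchSwinnertonDyer.Rank1Residual.X5.O1

end
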